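import Mathlib
import HarnessLib
import Summits.ResolutionOfSingularities.ResolutionOfSingularities.Theorems.WildQuotientsWildQuotientResolutionS1aBlowupChartNode

/-!
# SIG KC v1 — THE COBORDANT KILL CRITERION (plan-1 g13, 2026-08-28) [OURS · L1 W4.5c · counted 0]

NOT statements of the manuscript; a farm-checked SIGNATURE FILE (sorries by design) written by the crux planner
for the successor lead (lead-1 g10). AI-level planning, weaker than expert review. Crux stmt-ResolutionOfSingularities-17941
`CyclicQuotientFourfolds`, line `s1a-logminvertex` v10, K-side (`stub_killTouchReachAux`), SUCCESSOR-BRIEF v1.3 §4 item 1.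

THE POINT. The kill clause of `RingKillData` / `IsPrincipalChartData` / `IsPrincipalCentreChart` asks, for EVERY σ-fixed
cover element `b ∈ K_{d'}`, `d' > 0`, that the augmentation ideal of `sigmaChart` on the cobordant chart ring
`R^w[(b T^{d'})⁻¹]` be PRINCIPAL. All of these follow from ONE pair of ideal inclusions in the cobordant algebra
`R^w = B[s, fᵢ t^{wᵢ}]` itself (`CobordantKillCert`):
  (H1) `augIdeal σ_R ≤ (g)` — every increment is a multiple of one element `g` (for a kill: `g = β·s`, `β` the boundary
       monomial `ε^m`, `s = t⁻¹` the exceptional coordinate) — this is σ-ADMISSIBILITY with δ = 1 (TWISTED D-VAL-1;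
       lead-1ʼs `IsSigmaAdmissible` / `polyVal_admissible`, p633303 / AdmissibleCriteria);
  (H2) `g · vertexIdeal^N ≤ augIdeal σ_R` — `g` generates the augmentation ideal UP TO THE VERTEX `V(f₁t^{w₁}, …)`,
       which every chart of `B₊` inverts.
(H2) in turn follows (KC3) from (i) IRRELEVANCE OF THE INITIAL FORMS: modulo `s` (i.e. in `gr_w B = R^w/sR^w`, on the
exceptional divisor) the quotients `(σ_R z − z)/(β s)` generate an ideal containing a power of the vertex ideal — «the
shifted w-initial forms in_{v_w(y)+1} θ(y) of the twisted derivation θ = (σ − 1)/β have no common zero on E₊» — and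
(ii) ISOLATION downstairs: on the chart, the residual ideal `J = (augIdeal σ : β)` is `(f)`-coprimary (`(f)^N ≤ J`: the
centre is the whole bad locus of the chart, cf. `kill_away` p609690). So:  KILL(C, w)  ⟸  ADMISSIBLE(w, δ = 1) ∧
IN_w(θ) IRRELEVANT on E ∧ C = Bad ∩ O.  Every KILL node of the θ-LP censuses (THETA-LP-CENSUS v5–v8.1) is exactly a
certificate of (a′) + (i) + (ii) read on coordinates (the engineʼs MON test), so KC1–KC3 turn each census kill into a
one-line corollary and give `RingKillData` its FIRST inhabitants (KC4: the smooth transversal (2,1)-type, all p).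

Contents (signatures; proofs = lead-1 g10, `--supports stmt-ResolutionOfSingularities-17941 --as helper`, own names welcome):
* `CobordantKillCert f w σ hσJ hp hσp g`                                   — def (H1) ∧ (H2);
* KC1 `augmentationIdeal_sigmaChart_eq_span_of_cert`, `isPrincipal_augmentationIdeal_sigmaChart_of_cert`;
* KC2 `ringKillData_of_cert`                                               — node/centre data + cert ⇒ `RingKillData`;
* KC3 `cobordantKillCert_of_admissible_of_irrelevant`                      — (a′) ∧ (i) ∧ (ii) ⇒ cert with `g = β s`;
* KC4 `irrelevant_of_smoothTransversalType`                                — the (2,1)-type: `in θ(x₃) = h·x̄₁ʼ`, `in θ(x₄) = u·x̄₃ʼ`,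
  `h, u` units ⇒ (i).
-/

set_option linter.dupNamespace false

noncomputable section

open Literature.AlgebraicGeometry.Resolution
open Summit.ResolutionOfSingularities.ResolutionOfSingularities.Theorems.WildQuotientResolution.S1
open Summit.ResolutionOfSingularities.ResolutionOfSingularities.Theorems.WildQuotientResolution.S1.ProducerStep
open Summit.ResolutionOfSingularities.ResolutionOfSingularities.Theorems.WildQuotientResolution.S1.CoarseChart
open Summit.ResolutionOfSingularities.ResolutionOfSingularities.Theorems.WildQuotientResolution.S1.BlowupCharts

namespace Summit.ResolutionOfSingularities.ResolutionOfSingularities.Cruxes.CyclicQuotientFourfolds.KillCriterionSig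

universe u v

section Cert

variable {B : Type u} [CommRing B] {c : ℕ} (f : Fin c → B) (w : Fin c → ℕ) (σ : B ≃+* B)
  (hσJ : ∀ n : ℕ, ((weightedFiltration f w).ideal n).map (σ : B →+* B) ≤ (weightedFiltration f w).ideal n)
  {p : ℕ} (hp : 0 < p) (hσp : ∀ x : B, (⇑σ)^[p] x = x)

/-- **COBORDANT KILL CERTIFICATE** for `σ` along the weighted centre `(f, w)`: one element `g ∈ R^w` such that
(H1) every increment `σ_R z − z` is a multiple of `g` and (H2) `g · vertexIdeal^N ≤ augIdeal σ_R` for some `N`.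
For a genuine kill `g = β · s` (`β` = boundary monomial, `s = t⁻¹`). [OURS · L1 W4.5c · SIG KC v1] -/
def CobordantKillCert (g : ↥(cobordantAlgebra f w)) : Prop :=
  augmentationIdeal (sigmaR σ f w hσJ hp hσp) ≤ Ideal.span {g} ∧
    ∃ N : ℕ, Ideal.span {g} * cobordantAlgebra.vertexIdeal f w ^ N ≤ augmentationIdeal (sigmaR σ f w hσJ hp hσp)

/-- Positive-degree elements of `R^w` lie in the vertex ideal: the cover element `b T^d`, `b ∈ K_d`, `d > 0`.
[OURS · L1 W4.5c · SIG KC v1] -/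
theorem coverElement_mem_vertexIdeal {ι : Type v} [AddCommGroup ι] [DecidableEq ι] (𝒜 : ι → AddSubgroup B)
    [GradedRing 𝒜] {d : ℕ} (hd : 0 < d) (b : ↥(𝒜 0)) (hb : b ∈ (traceFiltration 𝒜 f w).ideal d) :
    coverElement 𝒜 f w d b hb ∈ cobordantAlgebra.vertexIdeal f w := by
  sorry

/-- **KC1.** A cobordant kill certificate makes the augmentation ideal of `σʼ = sigmaChart` on EVERY σ-fixed chart
`R^w[(b T^d)⁻¹]`, `d > 0`, equal to `(g)`. [OURS · L1 W4.5c · SIG KC v1] -/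
theorem augmentationIdeal_sigmaChart_eq_span_of_cert {ι : Type v} [AddCommGroup ι] [DecidableEq ι]
    (𝒜 : ι → AddSubgroup B) [GradedRing 𝒜] {d : ℕ} (hd : 0 < d) (b : ↥(𝒜 0))
    (hb : b ∈ (traceFiltration 𝒜 f w).ideal d) (hσb : σ (b : B) = b)
    {g : ↥(cobordantAlgebra f w)} (hcert : CobordantKillCert f w σ hσJ hp hσp g) :
    augmentationIdeal (sigmaChart 𝒜 f w d b hb σ hσJ hp hσp hσb) =
      Ideal.span {algebraMap (↥(cobordantAlgebra f w)) (ChartRing 𝒜 f w d b hb) g} := by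
  sorry

/-- **KC1ʼ.** … hence principal. [OURS · L1 W4.5c · SIG KC v1] -/
theorem isPrincipal_augmentationIdeal_sigmaChart_of_cert {ι : Type v} [AddCommGroup ι] [DecidableEq ι]
    (𝒜 : ι → AddSubgroup B) [GradedRing 𝒜] {d : ℕ} (hd : 0 < d) (b : ↥(𝒜 0))
    (hb : b ∈ (traceFiltration 𝒜 f w).ideal d) (hσb : σ (b : B) = b)
    {g : ↥(cobordantAlgebra f w)} (hcert : CobordantKillCert f w σ hσJ hp hσp g) :
    (augmentationIdeal (sigmaChart 𝒜 f w d b hb σ hσJ hp hσp hσb)).IsPrincipal :=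
  ⟨⟨_, by rw [augmentationIdeal_sigmaChart_eq_span_of_cert f w σ hσJ hp hσp 𝒜 hd b hb hσb hcert,
    Ideal.submodule_span_eq]⟩⟩

/-- **KC3 — THE INITIAL-FORM KILL CRITERION.** `β ∈ B` a non-zero-divisor (the boundary monomial `ε^m`);
(a′) boundary-admissibility with δ = 1: `y ∈ 𝒥ₙ ⇒ σ y − y ∈ β · 𝒥ₙ₊₁` (⇒ (H1) with `g = β s`);
(ii) isolation: `(f)^N ≤ (augIdeal σ : β)` (the centre is the whole residual bad locus of the chart);
(i) irrelevance of the initial forms: `vertexIdeal^N ≤ (augIdeal σ_R : β s) ⊔ (s)` (on the exceptional divisor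
`s = 0` the quotients of the increments have no common zero off the vertex). Then `β s` is a cobordant kill
certificate. (Proof idea: `V((augIdeal σ_R : β s)) ⊆ V(s = 0 part) ∪ V(J) × 𝔾_m ⊆ V(vertexIdeal)`, Noetherian.)
[OURS · L1 W4.5c · SIG KC v1] -/
theorem cobordantKillCert_of_admissible_of_irrelevant [IsNoetherianRing B] (β : B) (hβ : β ∈ nonZeroDivisors B)
    (hadm : ∀ (n : ℕ) (y : B), y ∈ (weightedFiltration f w).ideal n →
      σ y - y ∈ Ideal.span {β} * (weightedFiltration f w).ideal (n + 1))
    (hiso : ∃ N : ℕ, Ideal.span (Set.range f) ^ N ≤ (augmentationIdeal σ).colon (Ideal.span {β}))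
    (hirr : ∃ N : ℕ, cobordantAlgebra.vertexIdeal f w ^ N ≤
      (augmentationIdeal (sigmaR σ f w hσJ hp hσp)).colon
          (Ideal.span {algebraMap B (↥(cobordantAlgebra f w)) β * cobordantAlgebra.s f w}) ⊔
        cobordantAlgebra.excIdeal f w) :
    CobordantKillCert f w σ hσJ hp hσp (algebraMap B (↥(cobordantAlgebra f w)) β * cobordantAlgebra.s f w) := by
  sorry

/-- **KC4 — the smooth transversal (2,1)-type** (the census kill leaf, all `p`): centre `f = (x₁, x₃)` with weights
`(2, 1)`; any further element `x₄`; units `h u : B`; and the two initial-form data `σ x₃ − x₃ − β h x₁ ∈ β 𝒥₃`,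
`σ x₄ − x₄ − β u x₃ ∈ β 𝒥₂` (in words: `in₂ θ(x₃) = h̄·x̄₁ʼ`, `in₁ θ(x₄) = ū·x̄₃ʼ`). Then the initial forms are
irrelevant, i.e. hypothesis (i) of KC3 holds with `N = 1` (`h x₁ʼ + s·(…)` and `u x₃ʼ + s·(…)` lie in the colon ideal:
`σ_R x₃ʼ − x₃ʼ = β s (h x₁ʼ + s j₃ʼ)`, `σ_R x₄ − x₄ = β s (u x₃ʼ + s j₂ʼ)`). Admissibility (a′) and isolation (ii) are
NOT needed here — they enter only through KC3.
[OURS · L1 W4.5c · SIG KC v1] -/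
theorem irrelevant_of_smoothTransversalType (f : Fin 2 → B) (β x₄ h u : B) (hh : IsUnit h) (hu : IsUnit u)
    (hσJ : ∀ n : ℕ, ((weightedFiltration f ![2, 1]).ideal n).map (σ : B →+* B) ≤ (weightedFiltration f ![2, 1]).ideal n)
    (h₃ : σ (f 1) - f 1 - β * h * f 0 ∈ Ideal.span {β} * (weightedFiltration f ![2, 1]).ideal 3)
    (h₄ : σ x₄ - x₄ - β * u * f 1 ∈ Ideal.span {β} * (weightedFiltration f ![2, 1]).ideal 2) :
    cobordantAlgebra.vertexIdeal f ![2, 1] ≤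
      (augmentationIdeal (sigmaR σ f ![2, 1] hσJ hp hσp)).colon
          (Ideal.span {algebraMap B (↥(cobordantAlgebra f ![2, 1])) β * cobordantAlgebra.s f ![2, 1]}) ⊔
        cobordantAlgebra.excIdeal f ![2, 1] := by
  sorry

end Cert

section Node

variable {p : ℕ} {m : ℕ} (r : Fin m → ℕ) (B : Type u) [CommRing B] (𝒜 : (Π j : Fin m, ZMod (r j)) → AddSubgroup B)
  [GradedRing 𝒜] (σ : B ≃+* B)

/-- **KC2.** Centre data of a node (K1′-regular σ-adapted homogeneous weighted centre, a Veronese degree) + a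
cobordant kill certificate for every admissible `(hp, hσp)` ⇒ `RingKillData`. [OURS · L1 W4.5c · SIG KC v1] -/
theorem ringKillData_of_cert {c : ℕ} (f : Fin c → B) (δ : Fin c → Π j : Fin m, ZMod (r j)) (w : Fin c → ℕ) (d : ℕ)
    (hc : 0 < c) (hf : ∀ i, f i ∈ 𝒜 (δ i)) (hw : ∀ i, 0 < w i)
    (hK1 : RingTheory.Sequence.IsRegular B (List.ofFn f)) (hK1' : IsRegularRing (B ⧸ Ideal.span (Set.range f)))
    (hσJ : ∀ n : ℕ, ((weightedFiltration f w).ideal n).map (σ : B →+* B) ≤ (weightedFiltration f w).ideal n)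
    (hver : VeroneseNormalised 𝒜 f w d)
    (hcert : ∀ (hp : 0 < p) (hσp : ∀ x : B, (⇑σ)^[p] x = x),
      ∃ g : ↥(cobordantAlgebra f w), KillCriterionSig.CobordantKillCert f w σ hσJ hp hσp g) :
    RingKillData p r B 𝒜 σ := by
  refine ⟨c, f, δ, w, d, hc, hf, hw, hK1, hK1', hσJ, hver, ?_⟩
  intro hp hσp d' b hb hσb hd'
  obtain ⟨g, hg⟩ := hcert hp hσp
  exact KillCriterionSig.isPrincipal_augmentationIdeal_sigmaChart_of_cert f w σ hσJ hp hσp 𝒜 hd' b hb hσb hg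

end Node

end Summit.ResolutionOfSingularities.ResolutionOfSingularities.Cruxes.CyclicQuotientFourfolds.KillCriterionSig
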